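/-
Copyright (c) 2026 the pub-hodgecm-mathlib formalisation cell (harness21).  Prover seat hodgecm-mathlib-K2E3-p20 (g5), Track B «K2-LIT» ∕ h413
(`stmt-HodgeConjecture-24833`), line `K2_E3_EllipticInputs`, unit U12 §L, kernel road «RICHARDSON» for (L-B_GL) at `N = 3` (road owner K2E3-p11 (g4)),
leaf (LBGL-3J) «Borel slice density of 𝔤𝔩₃» (hand K2E3-p17 (g6), census (D60)), brick A (A2): THE `𝔟`-FUBINI FORM OF THE BOREL SLICE.  2026-09-04.
-/
import Summits.HodgeConjecture.HodgeConjecture.Theorems.K2E3GL3LieUnipotentTwist       -- ★ p857593 (this seat): (A1) `lintegral_conj_diagonal_eq` (the Lie twist at a regular diagonal)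
import Literature.NumberTheory.Automorphic.LocalFieldHaarBalls                      -- ★ `LocalFieldHaar.measure_singleton_zero` (points are null for an additive Haar measure on `F`)
import Literature.NumberTheory.Automorphic.GLnGelfandKazhdanInvolution              -- ★ `t2Space_generalLinearGroup`, `locallyCompactSpace_generalLinearGroup`
import Literature.NumberTheory.Automorphic.UnipotentRadicalCompactOpenProofs        -- ★ `isClosed_unipotentRadicalGL`
import HarnessLib

/-!
# K2_E3 road (h413), §L — (LBGL-3J) brick A (A2): the `K`-average of the Borel slice of `𝔤𝔩₃(F)` as a `𝔱`-integral of `‖D‖^{1∕2}`-weighted `K N₃`-orbital integrals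

Cell `pub/hodgecm-mathlib` (D-0151), Track B, seat K2E3-p20 (g5); leaf hand K2E3-p17 (g6) (CENSUS-SBflatLie-N3 §1 (i)–(ii), §3 brick A), road owner K2E3-p11 (g4),
dealer K2E3-plan (g3).  `--supports stmt-HodgeConjecture-24833 --as helper`; THEOREMS ONLY (no definition ∕ instance ∕ notation ∕ named fact ∕ `sorry`); never imports
`Cruxes/…/Lines`.  COUNT-NEUTRAL ((LBGL-3J) ∕ (LBGL-ge3) ∕ (L-B_GL) stay OPEN).

THE MATHEMATICS.  `K = GL₃(𝒪)` with Haar `κ`, `N₃` upper unitriangular with Haar `μ_N`, `dx` an additive Haar measure on `F`; `b(r) = [[r₀,r₁,r₂],[0,r₃,r₄],[0,0,r₅]]`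
(`r ∈ F⁶`) the Borel slice.  Splitting `𝔟 = 𝔱 ⊕ 𝔫₃` (`measurePreserving_mergeChart`: `(d, r′) ↦ (d₀, r′₀, r′₁, d₁, r′₂, d₂)` carries `dx^{⊗3} ⊗ dx^{⊗3}` to `dx^{⊗6}`),
applying ★ (A1) `lintegral_conj_diagonal_eq` to `f ∘ Ad(k)` at every REGULAR diagonal `d` — almost every `d` (`ae_pairwise_ne`: `{dᵢ = dⱼ}` is `dx^{⊗3}`-null since points
are `dx`-null, ★ `measure_singleton_zero`) — and Tonelli:
  **`lintegral_glInt_upperSlice_eq` (A2): `∃ C′ ∈ (0, ∞)`, ∀ Borel `f ≥ 0`,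
  `∫⁻_K ∫⁻_{F⁶} f(k b(r) k⁻¹) d(dx^{⊗6}) dκ = C′ · ∫⁻_{F³} ‖(d₀−d₁)(d₀−d₂)(d₁−d₂)‖_F · ∫⁻_{K×N₃} f((ku) diag(d) (ku)⁻¹) d(κ⊗μ_N) d(dx^{⊗3})`** —
the LHS of the (F-J)∕(LBGL-3J) head as a `𝔱`-integral of the `K N₃`-orbital integrals of ★ brick D `K2E3GL3KNOrbitalAdInvariant` (K2E3-p03 (g4)) with the weight
`‖D(d)‖^{1∕2} = ‖Πᵢ₍<ⱼ(dᵢ−dⱼ)‖_F`.  [HarishChandra1999AdmissibleDistributions, Lemma 7.8, Thm. 7.5, §7]; [HarishChandra1970, Part I §2 Lemma 3, Part V Lemma 22].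

HONEST LABEL: HC_CM is proved only modulo the 7 printed citations (2 remaining named inputs: hLiu418 = stmt-HodgeConjecture-24832, h413 = stmt-HodgeConjecture-24833)
until rung 0 closes; count-neutral helper.
-/

set_option autoImplicit false
set_option linter.dupNamespace false   -- `Summit.HodgeConjecture.HodgeConjecture.…` (D-0017 nested layout; lakefile exemption for Summits)

noncomputable section

open MeasureTheory MeasureTheory.Measure Filter Topology TopologicalSpace
open scoped MatrixGroups NNReal ENNReal
open Literature.NumberTheory.Automorphic
open Literature.NumberTheory.GaloisRepresentations Literature.NumberTheory.GaloisRepresentations.IsNonarchimedeanLocalField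
open Summit.HodgeConjecture.HodgeConjecture.Cruxes.H413.K2E3GL3LieUnipotentTwist

namespace Summit.HodgeConjecture.HodgeConjecture.Cruxes.H413.K2E3GL3UpperSliceFubini

section Twist

variable (F : Type*) [Field F] [ValuativeRel F] [TopologicalSpace F] [IsNonarchimedeanLocalField F]
  [MeasurableSpace F] [BorelSpace F] [MeasurableSpace (GL (Fin 3) F)] [BorelSpace (GL (Fin 3) F)]
  [MeasurableSpace (Matrix (Fin 3) (Fin 3) F)] [BorelSpace (Matrix (Fin 3) (Fin 3) F)]

/-! ## §1–§2  (A2) The `𝔟`-Fubini form: `∫_K∫_𝔟 f(Ad k b) = C′ ∫_{𝔱} ‖D(d)‖^{1∕2}·(∫_{K×N₃} f(Ad(ku) d))` -/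

omit [Field F] [ValuativeRel F] [TopologicalSpace F] [IsNonarchimedeanLocalField F] [BorelSpace F] [MeasurableSpace (GL (Fin 3) F)] [BorelSpace (GL (Fin 3) F)]
  [MeasurableSpace (Matrix (Fin 3) (Fin 3) F)] [BorelSpace (Matrix (Fin 3) (Fin 3) F)] in
/-- **The split `F⁶ = F³ × F³` (diagonal ∕ strictly upper entries) preserves the product measures**: `(d, r′) ↦ (d₀, r′₀, r′₁, d₁, r′₂, d₂)` carries
`dx^{⊗3} ⊗ dx^{⊗3}` to `dx^{⊗6}`. [folklore] -/
theorem measurePreserving_mergeChart (dx : Measure F) [SigmaFinite dx] :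
    MeasurePreserving (fun p : (Fin 3 → F) × (Fin 3 → F) => (![p.1 0, p.2 0, p.2 1, p.1 1, p.2 2, p.1 2] : Fin 6 → F))
      ((Measure.pi fun _ : Fin 3 => dx).prod (Measure.pi fun _ : Fin 3 => dx)) (Measure.pi fun _ : Fin 6 => dx) := by
  have hm : Measurable fun p : (Fin 3 → F) × (Fin 3 → F) => (![p.1 0, p.2 0, p.2 1, p.1 1, p.2 2, p.1 2] : Fin 6 → F) := by
    refine measurable_pi_iff.2 fun i => ?_
    fin_cases i <;> simp <;> fun_prop
  refine ⟨hm, ?_⟩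
  symm
  refine Measure.pi_eq fun s hs => ?_
  rw [Measure.map_apply hm (MeasurableSet.univ_pi hs)]
  have hpre : (fun p : (Fin 3 → F) × (Fin 3 → F) => (![p.1 0, p.2 0, p.2 1, p.1 1, p.2 2, p.1 2] : Fin 6 → F)) ⁻¹' Set.pi Set.univ s =
      (Set.pi Set.univ fun i : Fin 3 => s (![0, 3, 5] i)) ×ˢ (Set.pi Set.univ fun i : Fin 3 => s (![1, 2, 4] i)) := by
    ext ⟨d, r⟩
    simp only [Set.mem_preimage, Set.mem_univ_pi, Set.mem_prod]
    constructor
    · intro h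
      exact ⟨fun i => by fin_cases i <;> [exact h 0; exact h 3; exact h 5], fun i => by fin_cases i <;> [exact h 1; exact h 2; exact h 4]⟩
    · rintro ⟨h1, h2⟩ i
      fin_cases i
      · exact h1 0
      · exact h2 0
      · exact h2 1
      · exact h1 1
      · exact h2 2
      · exact h1 2
  rw [hpre, Measure.prod_prod, Measure.pi_pi, Measure.pi_pi, Fin.prod_univ_six, Fin.prod_univ_three, Fin.prod_univ_three]
  simp only [Matrix.cons_val_zero, Matrix.cons_val_one, Matrix.cons_val_two, Matrix.head_cons, Matrix.tail_cons]
  ring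

omit [MeasurableSpace (GL (Fin 3) F)] [BorelSpace (GL (Fin 3) F)] [MeasurableSpace (Matrix (Fin 3) (Fin 3) F)] [BorelSpace (Matrix (Fin 3) (Fin 3) F)] in
/-- **Almost every diagonal is regular**: `{d | dᵢ = dⱼ}` (`i ≠ j`) is `dx^{⊗3}`-null for an additive Haar measure `dx` on the (non-discrete) local field `F`
(★ `measure_singleton_zero` + translation invariance ⇒ points are null ⇒ coordinate hyperplanes of `dx^{⊗2}` are null, by Tonelli). [folklore] -/
theorem ae_pairwise_ne (dx : Measure F) [dx.IsAddHaarMeasure] :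
    ∀ᵐ d : Fin 3 → F ∂(Measure.pi fun _ : Fin 3 => dx), d 0 ≠ d 1 ∧ d 0 ≠ d 2 ∧ d 1 ≠ d 2 := by
  haveI : T2Space F := (isLocalField F).toT2Space
  haveI : LocallyCompactSpace F := (isLocalField F).toLocallyCompactSpace
  haveI : SecondCountableTopology F := secondCountableTopology_localField F
  haveI : IsTopologicalRing F := inferInstance
  haveI : SFinite dx := inferInstance
  -- points are `dx`-null
  haveI : NullSingletonClass dx := ⟨fun a => by
    have h := measure_preimage_add dx (-a) ({0} : Set F)
    rw [show (fun h : F => -a + h) ⁻¹' ({0} : Set F) = {a} by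
      ext x; simp only [Set.mem_preimage, Set.mem_singleton_iff]; constructor <;> intro hx <;> linear_combination hx] at h
    rw [h]
    exact LocalFieldHaar.measure_singleton_zero dx⟩
  -- a coordinate pair `(i, j)`, `i ≠ j`: `{d | d i = d j}` is null, through the projection `d ↦ (d i, d ∘ succAbove i)`
  have hnull : ∀ (i : Fin 3) (j' : Fin 2), (Measure.pi fun _ : Fin 3 => dx) {d : Fin 3 → F | d i = d (i.succAbove j')} = 0 := by
    intro i j'
    have hmp := measurePreserving_piFinSuccAbove (fun _ : Fin 3 => dx) i
    have hset : {d : Fin 3 → F | d i = d (i.succAbove j')} =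
        (MeasurableEquiv.piFinSuccAbove (fun _ : Fin 3 => F) i) ⁻¹' {p : F × (Fin 2 → F) | p.1 = p.2 j'} := by
      ext d; rfl
    have hmeas : MeasurableSet {p : F × (Fin 2 → F) | p.1 = p.2 j'} :=
      measurableSet_eq_fun measurable_fst ((measurable_pi_apply j').comp measurable_snd)
    rw [hset, hmp.measure_preimage hmeas.nullMeasurableSet, Measure.prod_apply hmeas]
    refine lintegral_eq_zero_of_ae_eq_zero (Eventually.of_forall fun x => ?_)
    show (Measure.pi fun _ : Fin 2 => dx) (Prod.mk x ⁻¹' {p : F × (Fin 2 → F) | p.1 = p.2 j'}) = 0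
    have : Prod.mk x ⁻¹' {p : F × (Fin 2 → F) | p.1 = p.2 j'} = {g : Fin 2 → F | g j' = x} := by
      ext g; exact ⟨fun h => (h : x = g j').symm, fun h => (h : g j' = x).symm⟩
    rw [this]
    exact Measure.pi_hyperplane (fun _ : Fin 2 => dx) j' x
  have h01 := hnull 0 0
  have h02 := hnull 0 1
  have h12 := hnull 1 1
  simp only [Fin.succAbove] at h01 h02 h12
  rw [ae_iff]
  refine measure_mono_null (fun d hd => ?_) (measure_union_null (measure_union_null h01 h02) h12)
  simp only [not_and_or, not_not, Set.mem_setOf_eq] at hd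
  simp only [Set.mem_union, Set.mem_setOf_eq]
  rcases hd with h | h | h
  · exact Or.inl (Or.inl (by simpa using h))
  · exact Or.inl (Or.inr (by simpa using h))
  · exact Or.inr (by simpa using h)

omit [ValuativeRel F] [TopologicalSpace F] [IsNonarchimedeanLocalField F] [MeasurableSpace F] [BorelSpace F] [MeasurableSpace (GL (Fin 3) F)]
  [BorelSpace (GL (Fin 3) F)] [MeasurableSpace (Matrix (Fin 3) (Fin 3) F)] [BorelSpace (Matrix (Fin 3) (Fin 3) F)] in
/-- `Ad(k)(Ad(u) S) = Ad(k u) S`. [folklore] -/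
theorem conj_conj (k u : GL (Fin 3) F) (S : Matrix (Fin 3) (Fin 3) F) :
    (k : Matrix (Fin 3) (Fin 3) F) * ((u : Matrix (Fin 3) (Fin 3) F) * S * ((u⁻¹ : GL (Fin 3) F) : Matrix (Fin 3) (Fin 3) F)) *
        ((k⁻¹ : GL (Fin 3) F) : Matrix (Fin 3) (Fin 3) F) =
      ((k * u : GL (Fin 3) F) : Matrix (Fin 3) (Fin 3) F) * S * (((k * u)⁻¹ : GL (Fin 3) F) : Matrix (Fin 3) (Fin 3) F) := by
  rw [mul_inv_rev, Units.val_mul, Units.val_mul]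
  simp only [Matrix.mul_assoc]

/-- **(A2) THE `𝔟`-FUBINI FORM OF THE BOREL SLICE.**  For Haar measures `κ` on `GL₃(𝒪)`, `μ_N` on `N₃` and an additive Haar measure `dx` on `F` there is ONE
`C′ ∈ (0, ∞)` such that for every Borel `f : 𝔤𝔩₃(F) → [0, ∞]`:
**`∫⁻_K ∫⁻_{F⁶} f(k · b(r) · k⁻¹) d(dx^{⊗6}) dκ = C′ · ∫⁻_{F³} ‖(d₀−d₁)(d₀−d₂)(d₁−d₂)‖_F · ∫⁻_{K×N₃} f((ku) · diag d · (ku)⁻¹) d(κ ⊗ μ_N) d(dx^{⊗3})`**,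
`b(r) = [[r₀,r₁,r₂],[0,r₃,r₄],[0,0,r₅]]` — the `K`-average of the Borel slice as a `𝔱`-integral of `‖D‖^{1∕2}`-weighted `K N₃`-orbital integrals (the LHS of the
(F-J) ∕ (LBGL-3J) head against the orbital functional of ★ brick D `K2E3GL3KNOrbitalAdInvariant`).  Proof: §3 split + (A1) at the a.e.-regular `d` + Tonelli.
[cite: HarishChandra1999AdmissibleDistributions, Lemma 7.8, Thm. 7.5, §7] [cite: HarishChandra1970, Part I §2, Lemma 3] -/
theorem lintegral_glInt_upperSlice_eq (κ : Measure ↥(glInt 3 F)) [IsHaarMeasure κ] (μN : Measure ↥(unipotentRadicalGL F (id : Fin 3 → Fin 3))) [IsHaarMeasure μN]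
    (dx : Measure F) [dx.IsAddHaarMeasure] :
    ∃ C : ℝ≥0∞, C ≠ 0 ∧ C ≠ ∞ ∧ ∀ f : Matrix (Fin 3) (Fin 3) F → ℝ≥0∞, Measurable f →
      ∫⁻ k : ↥(glInt 3 F), ∫⁻ r : Fin 6 → F,
          f (((k : GL (Fin 3) F) : Matrix (Fin 3) (Fin 3) F) * !![r 0, r 1, r 2; 0, r 3, r 4; 0, 0, r 5] *
            ((((k : GL (Fin 3) F))⁻¹ : GL (Fin 3) F) : Matrix (Fin 3) (Fin 3) F)) ∂(Measure.pi fun _ : Fin 6 => dx) ∂κ =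
        C * ∫⁻ d : Fin 3 → F, (normAbs F ((d 0 - d 1) * (d 0 - d 2) * (d 1 - d 2)) : ℝ≥0∞) *
          ∫⁻ q : ↥(glInt 3 F) × ↥(unipotentRadicalGL F (id : Fin 3 → Fin 3)),
            f ((((q.1 : GL (Fin 3) F) * (q.2 : GL (Fin 3) F) : GL (Fin 3) F) : Matrix (Fin 3) (Fin 3) F) * Matrix.diagonal d *
              ((((q.1 : GL (Fin 3) F) * (q.2 : GL (Fin 3) F))⁻¹ : GL (Fin 3) F) : Matrix (Fin 3) (Fin 3) F)) ∂(κ.prod μN)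
          ∂(Measure.pi fun _ : Fin 3 => dx) := by
  haveI : T2Space F := (isLocalField F).toT2Space
  haveI : LocallyCompactSpace F := (isLocalField F).toLocallyCompactSpace
  haveI : SecondCountableTopology F := secondCountableTopology_localField F
  haveI : IsTopologicalRing F := inferInstance
  haveI : SFinite dx := inferInstance
  haveI : T2Space (GL (Fin 3) F) := t2Space_generalLinearGroup F 3
  haveI : SecondCountableTopology (Matrix (Fin 3) (Fin 3) F) := inferInstanceAs (SecondCountableTopology (Fin 3 → Fin 3 → F))
  haveI : SecondCountableTopology (Matrix (Fin 3) (Fin 3) F)ᵐᵒᵖ := MulOpposite.opHomeomorph.symm.secondCountableTopology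
  haveI : SecondCountableTopology (GL (Fin 3) F) := Units.isEmbedding_embedProduct.secondCountableTopology
  haveI : SecondCountableTopology ↥(glInt 3 F) := TopologicalSpace.Subtype.secondCountableTopology _
  haveI : SecondCountableTopology ↥(unipotentRadicalGL F (id : Fin 3 → Fin 3)) := TopologicalSpace.Subtype.secondCountableTopology _
  haveI : BorelSpace ↥(glInt 3 F) := Subtype.borelSpace _
  haveI : BorelSpace ↥(unipotentRadicalGL F (id : Fin 3 → Fin 3)) := Subtype.borelSpace _
  haveI : BorelSpace (↥(glInt 3 F) × ↥(unipotentRadicalGL F (id : Fin 3 → Fin 3))) := Prod.borelSpace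
  haveI : LocallyCompactSpace (GL (Fin 3) F) := locallyCompactSpace_generalLinearGroup F 3
  haveI : LocallyCompactSpace ↥(unipotentRadicalGL F (id : Fin 3 → Fin 3)) := (isClosed_unipotentRadicalGL (R := F) (id : Fin 3 → Fin 3)).locallyCompactSpace
  haveI : SFinite μN := inferInstance
  haveI : CompactSpace ↥(glInt 3 F) := isCompact_iff_compactSpace.1 (isCompact_glInt (n := 3) (F := F))
  haveI : IsFiniteMeasure κ := CompactSpace.isFiniteMeasure
  obtain ⟨C, hC0, hCtop, hA1⟩ := lintegral_conj_diagonal_eq F μN dx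
  refine ⟨C⁻¹, ENNReal.inv_ne_zero.2 hCtop, ENNReal.inv_ne_top.2 hC0, fun f hf => ?_⟩
  -- notation-free abbreviations
  have hAdc : ∀ g : GL (Fin 3) F, Continuous fun S : Matrix (Fin 3) (Fin 3) F => (g : Matrix (Fin 3) (Fin 3) F) * S * ((g⁻¹ : GL (Fin 3) F) : Matrix (Fin 3) (Fin 3) F) :=
    fun g => (continuous_const.mul continuous_id).mul continuous_const
  have hslice : Continuous fun p : (Fin 3 → F) × (Fin 3 → F) => (Matrix.diagonal p.1 + !![0, p.2 0, p.2 1; 0, 0, p.2 2; 0, 0, 0] : Matrix (Fin 3) (Fin 3) F) := by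
    have h1 : Continuous fun p : (Fin 3 → F) × (Fin 3 → F) => (Matrix.diagonal p.1 : Matrix (Fin 3) (Fin 3) F) := continuous_fst.matrix_diagonal
    have h2 : Continuous fun p : (Fin 3 → F) × (Fin 3 → F) => (!![0, p.2 0, p.2 1; 0, 0, p.2 2; 0, 0, 0] : Matrix (Fin 3) (Fin 3) F) := by
      refine continuous_matrix fun i j => ?_
      fin_cases i <;> fin_cases j <;> simp <;> fun_prop
    exact h1.add h2
  -- STEP 1: split `F⁶ = F³ × F³` inside the `K`-integral
  have hb : ∀ p : (Fin 3 → F) × (Fin 3 → F),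
      (!![(![p.1 0, p.2 0, p.2 1, p.1 1, p.2 2, p.1 2] : Fin 6 → F) 0, (![p.1 0, p.2 0, p.2 1, p.1 1, p.2 2, p.1 2] : Fin 6 → F) 1,
          (![p.1 0, p.2 0, p.2 1, p.1 1, p.2 2, p.1 2] : Fin 6 → F) 2;
         0, (![p.1 0, p.2 0, p.2 1, p.1 1, p.2 2, p.1 2] : Fin 6 → F) 3, (![p.1 0, p.2 0, p.2 1, p.1 1, p.2 2, p.1 2] : Fin 6 → F) 4;
         0, 0, (![p.1 0, p.2 0, p.2 1, p.1 1, p.2 2, p.1 2] : Fin 6 → F) 5] : Matrix (Fin 3) (Fin 3) F) =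
        Matrix.diagonal p.1 + !![0, p.2 0, p.2 1; 0, 0, p.2 2; 0, 0, 0] := fun p => by
    ext i j
    fin_cases i <;> fin_cases j <;> simp [Matrix.cons_val]
  have hstep1 : ∀ k : ↥(glInt 3 F),
      ∫⁻ r : Fin 6 → F, f (((k : GL (Fin 3) F) : Matrix (Fin 3) (Fin 3) F) * !![r 0, r 1, r 2; 0, r 3, r 4; 0, 0, r 5] *
          ((((k : GL (Fin 3) F))⁻¹ : GL (Fin 3) F) : Matrix (Fin 3) (Fin 3) F)) ∂(Measure.pi fun _ : Fin 6 => dx) =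
        ∫⁻ d : Fin 3 → F, ∫⁻ r : Fin 3 → F, f (((k : GL (Fin 3) F) : Matrix (Fin 3) (Fin 3) F) * (Matrix.diagonal d + !![0, r 0, r 1; 0, 0, r 2; 0, 0, 0]) *
          ((((k : GL (Fin 3) F))⁻¹ : GL (Fin 3) F) : Matrix (Fin 3) (Fin 3) F)) ∂(Measure.pi fun _ : Fin 3 => dx) ∂(Measure.pi fun _ : Fin 3 => dx) := fun k => by
    have hF : Measurable fun r : Fin 6 → F => f (((k : GL (Fin 3) F) : Matrix (Fin 3) (Fin 3) F) * !![r 0, r 1, r 2; 0, r 3, r 4; 0, 0, r 5] *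
        ((((k : GL (Fin 3) F))⁻¹ : GL (Fin 3) F) : Matrix (Fin 3) (Fin 3) F)) := by
      refine hf.comp ((hAdc k).comp (continuous_matrix fun i j => ?_)).measurable
      fin_cases i <;> fin_cases j <;> simp <;> fun_prop
    rw [← (measurePreserving_mergeChart F dx).lintegral_comp hF]
    have hG : Measurable fun p : (Fin 3 → F) × (Fin 3 → F) => f (((k : GL (Fin 3) F) : Matrix (Fin 3) (Fin 3) F) *
        (Matrix.diagonal p.1 + !![0, p.2 0, p.2 1; 0, 0, p.2 2; 0, 0, 0]) * ((((k : GL (Fin 3) F))⁻¹ : GL (Fin 3) F) : Matrix (Fin 3) (Fin 3) F)) :=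
      hf.comp ((hAdc k).comp hslice).measurable
    rw [← lintegral_prod _ hG.aemeasurable]
    refine lintegral_congr fun p => ?_
    simp only [hb p]
  -- STEP 2: (A1) at a regular `d`, for the test function `f ∘ Ad k`
  have hstep2 : ∀ (k : ↥(glInt 3 F)) (d : Fin 3 → F), d 0 ≠ d 1 ∧ d 0 ≠ d 2 ∧ d 1 ≠ d 2 →
      ∫⁻ r : Fin 3 → F, f (((k : GL (Fin 3) F) : Matrix (Fin 3) (Fin 3) F) * (Matrix.diagonal d + !![0, r 0, r 1; 0, 0, r 2; 0, 0, 0]) *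
          ((((k : GL (Fin 3) F))⁻¹ : GL (Fin 3) F) : Matrix (Fin 3) (Fin 3) F)) ∂(Measure.pi fun _ : Fin 3 => dx) =
        (C * ((normAbs F ((d 0 - d 1) * (d 0 - d 2) * (d 1 - d 2)))⁻¹ : ℝ≥0))⁻¹ *
          ∫⁻ u : ↥(unipotentRadicalGL F (id : Fin 3 → Fin 3)), f ((((k : GL (Fin 3) F) * (u : GL (Fin 3) F) : GL (Fin 3) F) : Matrix (Fin 3) (Fin 3) F) *
            Matrix.diagonal d * ((((k : GL (Fin 3) F) * (u : GL (Fin 3) F))⁻¹ : GL (Fin 3) F) : Matrix (Fin 3) (Fin 3) F)) ∂μN := by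
    rintro k d ⟨h01, h02, h12⟩
    have hreg : (d 0 - d 1) * (d 0 - d 2) * (d 1 - d 2) ≠ 0 :=
      mul_ne_zero (mul_ne_zero (sub_ne_zero.2 h01) (sub_ne_zero.2 h02)) (sub_ne_zero.2 h12)
    have hw : ((normAbs F ((d 0 - d 1) * (d 0 - d 2) * (d 1 - d 2)))⁻¹ : ℝ≥0) ≠ 0 := inv_ne_zero ((map_ne_zero _).2 hreg)
    have hφ : Measurable fun S : Matrix (Fin 3) (Fin 3) F => f (((k : GL (Fin 3) F) : Matrix (Fin 3) (Fin 3) F) * S *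
        ((((k : GL (Fin 3) F))⁻¹ : GL (Fin 3) F) : Matrix (Fin 3) (Fin 3) F)) := hf.comp (hAdc k).measurable
    have h := hA1 d h01 h02 h12 _ hφ
    simp only [conj_conj] at h
    rw [h, ← mul_assoc, ENNReal.inv_mul_cancel (mul_ne_zero hC0 (ENNReal.coe_ne_zero.2 hw)) (ENNReal.mul_ne_top hCtop ENNReal.coe_ne_top), one_mul]
  -- STEP 3: swap `∫⁻ k` and `∫⁻ d`, substitute STEP 2 for a.e. `d`, merge `∫⁻ k ∫⁻ u` into `∫⁻ (k, u)`
  have hmeas3 : Measurable fun x : (↥(glInt 3 F) × (Fin 3 → F)) × (Fin 3 → F) =>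
      f (((x.1.1 : GL (Fin 3) F) : Matrix (Fin 3) (Fin 3) F) * (Matrix.diagonal x.1.2 + !![0, x.2 0, x.2 1; 0, 0, x.2 2; 0, 0, 0]) *
        ((((x.1.1 : GL (Fin 3) F))⁻¹ : GL (Fin 3) F) : Matrix (Fin 3) (Fin 3) F)) := by
    refine hf.comp (Continuous.measurable ?_)
    exact (((Units.continuous_val.comp (continuous_subtype_val.comp (continuous_fst.comp continuous_fst))).mul
      (hslice.comp ((continuous_snd.comp continuous_fst).prodMk continuous_snd))).mul
      (Units.continuous_coe_inv.comp (continuous_subtype_val.comp (continuous_fst.comp continuous_fst))))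
  have hswap := lintegral_lintegral_swap (μ := κ) (ν := (Measure.pi fun _ : Fin 3 => dx))
    (f := fun (k : ↥(glInt 3 F)) (d : Fin 3 → F) => ∫⁻ r : Fin 3 → F, f (((k : GL (Fin 3) F) : Matrix (Fin 3) (Fin 3) F) *
      (Matrix.diagonal d + !![0, r 0, r 1; 0, 0, r 2; 0, 0, 0]) * ((((k : GL (Fin 3) F))⁻¹ : GL (Fin 3) F) : Matrix (Fin 3) (Fin 3) F)) ∂(Measure.pi fun _ : Fin 3 => dx))
    (Measurable.lintegral_prod_right' hmeas3).aemeasurable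
  have hmeasKU : ∀ d : Fin 3 → F, Measurable fun q : ↥(glInt 3 F) × ↥(unipotentRadicalGL F (id : Fin 3 → Fin 3)) =>
      f ((((q.1 : GL (Fin 3) F) * (q.2 : GL (Fin 3) F) : GL (Fin 3) F) : Matrix (Fin 3) (Fin 3) F) * Matrix.diagonal d *
        ((((q.1 : GL (Fin 3) F) * (q.2 : GL (Fin 3) F))⁻¹ : GL (Fin 3) F) : Matrix (Fin 3) (Fin 3) F)) := fun d => by
    have hc : Continuous fun q : ↥(glInt 3 F) × ↥(unipotentRadicalGL F (id : Fin 3 → Fin 3)) => (q.1 : GL (Fin 3) F) * (q.2 : GL (Fin 3) F) :=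
      (continuous_subtype_val.comp continuous_fst).mul (continuous_subtype_val.comp continuous_snd)
    exact hf.comp (((Units.continuous_val.comp hc).mul continuous_const).mul (Units.continuous_coe_inv.comp hc)).measurable
  calc ∫⁻ k : ↥(glInt 3 F), ∫⁻ r : Fin 6 → F, f (((k : GL (Fin 3) F) : Matrix (Fin 3) (Fin 3) F) * !![r 0, r 1, r 2; 0, r 3, r 4; 0, 0, r 5] *
            ((((k : GL (Fin 3) F))⁻¹ : GL (Fin 3) F) : Matrix (Fin 3) (Fin 3) F)) ∂(Measure.pi fun _ : Fin 6 => dx) ∂κ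
      = ∫⁻ k : ↥(glInt 3 F), ∫⁻ d : Fin 3 → F, ∫⁻ r : Fin 3 → F, f (((k : GL (Fin 3) F) : Matrix (Fin 3) (Fin 3) F) *
            (Matrix.diagonal d + !![0, r 0, r 1; 0, 0, r 2; 0, 0, 0]) * ((((k : GL (Fin 3) F))⁻¹ : GL (Fin 3) F) : Matrix (Fin 3) (Fin 3) F))
            ∂(Measure.pi fun _ : Fin 3 => dx) ∂(Measure.pi fun _ : Fin 3 => dx) ∂κ := lintegral_congr fun k => hstep1 k
    _ = ∫⁻ d : Fin 3 → F, ∫⁻ k : ↥(glInt 3 F), ∫⁻ r : Fin 3 → F, f (((k : GL (Fin 3) F) : Matrix (Fin 3) (Fin 3) F) *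
            (Matrix.diagonal d + !![0, r 0, r 1; 0, 0, r 2; 0, 0, 0]) * ((((k : GL (Fin 3) F))⁻¹ : GL (Fin 3) F) : Matrix (Fin 3) (Fin 3) F))
            ∂(Measure.pi fun _ : Fin 3 => dx) ∂κ ∂(Measure.pi fun _ : Fin 3 => dx) := hswap
    _ = ∫⁻ d : Fin 3 → F, (C * ((normAbs F ((d 0 - d 1) * (d 0 - d 2) * (d 1 - d 2)))⁻¹ : ℝ≥0))⁻¹ *
          ∫⁻ q : ↥(glInt 3 F) × ↥(unipotentRadicalGL F (id : Fin 3 → Fin 3)),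
            f ((((q.1 : GL (Fin 3) F) * (q.2 : GL (Fin 3) F) : GL (Fin 3) F) : Matrix (Fin 3) (Fin 3) F) * Matrix.diagonal d *
              ((((q.1 : GL (Fin 3) F) * (q.2 : GL (Fin 3) F))⁻¹ : GL (Fin 3) F) : Matrix (Fin 3) (Fin 3) F)) ∂(κ.prod μN)
          ∂(Measure.pi fun _ : Fin 3 => dx) := by
        refine lintegral_congr_ae ((ae_pairwise_ne F dx).mono fun d hd => ?_)
        simp only [hstep2 _ d hd]
        rw [lintegral_const_mul' _ _ (ENNReal.inv_ne_top.2 (mul_ne_zero hC0 (ENNReal.coe_ne_zero.2 (inv_ne_zero ((map_ne_zero _).2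
          (mul_ne_zero (mul_ne_zero (sub_ne_zero.2 hd.1) (sub_ne_zero.2 hd.2.1)) (sub_ne_zero.2 hd.2.2))))))),
          lintegral_prod _ (hmeasKU d).aemeasurable]
    _ = C⁻¹ * ∫⁻ d : Fin 3 → F, (normAbs F ((d 0 - d 1) * (d 0 - d 2) * (d 1 - d 2)) : ℝ≥0∞) *
          ∫⁻ q : ↥(glInt 3 F) × ↥(unipotentRadicalGL F (id : Fin 3 → Fin 3)),
            f ((((q.1 : GL (Fin 3) F) * (q.2 : GL (Fin 3) F) : GL (Fin 3) F) : Matrix (Fin 3) (Fin 3) F) * Matrix.diagonal d *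
              ((((q.1 : GL (Fin 3) F) * (q.2 : GL (Fin 3) F))⁻¹ : GL (Fin 3) F) : Matrix (Fin 3) (Fin 3) F)) ∂(κ.prod μN)
          ∂(Measure.pi fun _ : Fin 3 => dx) := by
        rw [← lintegral_const_mul' _ _ (ENNReal.inv_ne_top.2 hC0)]
        refine lintegral_congr_ae ((ae_pairwise_ne F dx).mono fun d hd => ?_)
        have hreg : (d 0 - d 1) * (d 0 - d 2) * (d 1 - d 2) ≠ 0 :=
          mul_ne_zero (mul_ne_zero (sub_ne_zero.2 hd.1) (sub_ne_zero.2 hd.2.1)) (sub_ne_zero.2 hd.2.2)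
        have hx : normAbs F ((d 0 - d 1) * (d 0 - d 2) * (d 1 - d 2)) ≠ 0 := (map_ne_zero _).2 hreg
        simp only
        rw [← mul_assoc, ENNReal.mul_inv (Or.inl hC0) (Or.inl hCtop), ENNReal.coe_inv hx, inv_inv]

end Twist

end Summit.HodgeConjecture.HodgeConjecture.Cruxes.H413.K2E3GL3UpperSliceFubini

end
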